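import Literature.NumberTheory.LFunctions.KeiperPowerSeries
import HarnessLib

/-!
# RH-FREE discharges for `KeiperPowerSeries.lean` (cell `rh-crit/dbl`, row W2-Ke92): Keiper 1992,
# *Power series expansions of Riemann's `ξ` function*, Math. Comp. 58 (1992) 765–773

LINE 1 — LABEL: RH-FREE proofs of statements ABOUT an RH-EQUIVALENT criterion.  This file discharges
named facts of `Literature/NumberTheory/LFunctions/KeiperPowerSeries.lean`:

* `Keiper1992_rh_iff_radius_log_holds` — [Keiper1992] §1 p.765–766: «the Riemann hypothesis is
  equivalent to the radius of convergence being 1» for the series (20) `log(2ξ(1/s)) = Σ λ_k (1−s)^k`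
  (radius = Mathlib's `FormalMultilinearSeries.radius` of `Σ λ_k z^k`, `λ_k = keiperLambdaK k`).
  PROVED AS AN EQUIVALENCE (neither side asserted).  Route (Keiper: «the mapping `s ↦ 1/s` maps the
  critical line to the circle of radius 1 centered at `s = 1`»), in Li's variable `z = 1 − s`:
  - `Keiper1992.riemannHypothesis_of_one_le_radius`: radius `≥ 1` ⟹ the sum `g` of the series is
    holomorphic on the unit disc, `exp ∘ g = 2ξ(1/(1−z))` near `0` (Taylor, `Keiper1992_eq20`) hence on
    the disc (identity theorem) ⟹ `ξ(1/(1−z)) ≠ 0` on the disc ⟹ RH (tree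
    `riemannHypothesis_of_liPhi_ne_zero`, [Li1997] p.326);
  - `Keiper1992.one_le_radius_of_rh`: RH ⟹ `ξ(1/(1−z)) ≠ 0` on the disc ⟹ the Taylor series of
    `(ξ∘liMap)'/(ξ∘liMap)`, with coefficients `(k+1)λ_{k+1}`, converges on the disc ⟹ radius `≥ 1`;
  - `Keiper1992.radius_lamSeries_le_one`: radius `≤ 1` UNCONDITIONALLY — Hardy's theorem (tree
    `Hardy.riemannZeta_zeros_on_critical_line_infinite`) gives a zero `ρ` of `ξ` ON the line, i.e. a zero
    of `2ξ(1/(1−z))` at `z₀ = 1 − 1/ρ` with `|z₀| = 1`, incompatible with `exp ∘ g = 2ξ(1/(1−z))` beyond.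
* `Keiper1992_rh_iff_radius_logDeriv_holds` — the same sentence of [Keiper1992] §1 p.765–766 for the
  series (19) `ξ'(1/s)/ξ(1/s) = Σ τ_k (1−s)^k` (`τ_k = keiperTau k`): PROVED AS AN EQUIVALENCE.  `⟸`:
  radius `≥ 1` for (19) ⟹ radius `≥ 1` for (20) through (35) summed twice
  (`Keiper1992.one_le_radius_lamSeries_of_one_le_radius_tauSeries`) ⟹ RH as above; `⟹`: the Taylor
  series of `(ξ'/ξ) ∘ liMap` on the unit disc under RH (`Keiper1992.one_le_radius_tauSeries_of_rh`), and
  radius `≤ 1` UNCONDITIONALLY (`Keiper1992.radius_tauSeries_le_one`): the Hardy zero gives a POLE of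
  `ξ'(1/s)/ξ(1/s)` at `z₀` on the unit circle — if the radius exceeded `1`, the identity
  `g · (ξ∘liMap) · liMap² = (ξ∘liMap)'` ((19), identity theorem) would force orders of vanishing `≥ n`
  and `= n − 1` to agree at `z₀`.
* `Keiper1992_rh_of_tau_bounded_holds` — [Keiper1992] p.769: «if the `|τ_k|` are bounded, then by (19)
  the Riemann hypothesis must be true»: by (35) (`Keiper1992_eq35`, tree) bounded `τ_k` give
  `|λ_m| ≤ C m`, so the `λ`-series has radius `≥ 1`, whence RH by the first bullet.  RH-FREE
  implication whose HYPOTHESIS is of RH strength.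

* `Keiper1992_eq29_holds` — [Keiper1992] (29) p.768, `λ_k = −(1/k) Σ_{j≥1} C(j+k−1,k−1) σ_j`: from
  (27) (= [Coffey2008] (3.5), tree) by substituting (18) (= [Coffey2008] (4.10), tree) and
  Vandermonde's identity; `Keiper1992_eq25_holds` — (25) p.768, `τ_k = Σ_{j=1}^k C(k−1,j−1)(−1)^jσ_{j+1}`:
  from (35) and (27) by the second-difference Pascal identity `C(k+1,j) − 2C(k,j) + C(k−1,j) =
  C(k−1,j−2)`.  With them: `Keiper1992.zetaZeroPowerSum_im` (Keiper's `σ_k` are real, `k ≥ 1`).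

bears_on: LADDER-RH L-C/L-P (COLUMN 4 LI) + B-C/B-P (COLUMN 6 DBR).  WHAT THIS IS NOT: proving that a
criterion IS equivalent to RH fixes WHICH growth statement would prove RH; it does not move RH; no
side of any equivalence is asserted; nothing here bears on the truth of RH.

## References

* [Keiper1992] J. B. Keiper, Math. Comp. 58 (1992) 765–773, doi:10.1090/S0025-5718-1992-1122072-5.
* [Li1997] X.-J. Li, J. Number Theory 65 (1997) 325–333.
* [Hardy1914] G. H. Hardy, C. R. Acad. Sci. Paris 158 (1914) 1012–1014.
-/

noncomputable section

open Complex Filter Topology Finset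
open scoped Nat ComplexConjugate Real NNReal ENNReal

namespace Literature.NumberTheory.LFunctions

namespace Keiper1992

/-- `log(2ξ(1/(1−z)))` is analytic at `z = 0` (`2ξ(1) = 1`). [cite: Keiper1992, eq. (20) p.767] -/
theorem analyticAt_logTwoPhi : AnalyticAt ℂ (fun z ↦ Complex.log (2 * liPhi z)) 0 := by
  have hφ : AnalyticAt ℂ liPhi 0 :=
    differentiableOn_liPhi.analyticAt (Metric.ball_mem_nhds 0 one_pos)
  have h2 : AnalyticAt ℂ (fun z ↦ (2 : ℂ) * liPhi z) 0 := analyticAt_const.mul hφ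
  refine h2.clog ?_
  rw [liPhi_zero, Complex.mem_slitPlane_iff]; norm_num

/-- `2ξ(1/(1−z))` stays in the slit plane near `z = 0`. [cite: Keiper1992, eq. (20) p.767] -/
theorem eventually_twoPhi_mem_slitPlane : ∀ᶠ z in 𝓝 (0 : ℂ), 2 * liPhi z ∈ slitPlane := by
  have hc : ContinuousAt (fun z ↦ 2 * liPhi z) 0 :=
    (continuousAt_const.mul
      (differentiableOn_liPhi.differentiableAt (Metric.ball_mem_nhds 0 one_pos)).continuousAt)
  refine hc.eventually_mem (isOpen_slitPlane.mem_nhds ?_)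
  rw [liPhi_zero, Complex.mem_slitPlane_iff]; norm_num

/-- The sum of Keiper's `λ`-series is `Σ' λ_k z^k`. [cite: Keiper1992, eq. (20) p.767] -/
theorem lamSeries_sum_eq (z : ℂ) : (FormalMultilinearSeries.ofScalars ℂ (fun k ↦ (keiperLambdaK k : ℂ))).sum z = ∑' k, (keiperLambdaK k : ℂ) * z ^ k := by
  have := FormalMultilinearSeries.ofScalars_sum_eq (E := ℂ) (fun k ↦ (keiperLambdaK k : ℂ)) z
  simpa [FormalMultilinearSeries.ofScalarsSum, smul_eq_mul] using this

/-- Near `0`, the sum of the `λ`-series IS `log(2ξ(1/(1−z)))`, provided the series has positive radius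
(Taylor expansion of the analytic function `log(2 liPhi)` at `0`, whose coefficients are the `λ_k` by
`keiperLambdaK_coe`). [cite: Keiper1992, eq. (20) p.767] -/
theorem lamSeries_sum_eventuallyEq :
    (FormalMultilinearSeries.ofScalars ℂ (fun k ↦ (keiperLambdaK k : ℂ))).sum =ᶠ[𝓝 (0 : ℂ)] fun z ↦ Complex.log (2 * liPhi z) := by
  obtain ⟨r, hr0, hr⟩ := Metric.isOpen_iff.1 (isOpen_analyticAt ℂ (fun z ↦ Complex.log (2 * liPhi z)))
    0 analyticAt_logTwoPhi
  have hd : DifferentiableOn ℂ (fun z ↦ Complex.log (2 * liPhi z)) (Metric.ball 0 r) :=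
    fun z hz ↦ (hr hz).differentiableAt.differentiableWithinAt
  filter_upwards [Metric.ball_mem_nhds (0 : ℂ) hr0] with z hz
  have hT := Complex.hasSum_taylorSeries_on_ball hd hz
  rw [lamSeries_sum_eq]
  refine (HasSum.tsum_eq ?_)
  refine hT.congr_fun fun k ↦ ?_
  rw [keiperLambdaK_coe, smul_eq_mul, smul_eq_mul, sub_zero]
  ring

/-- If the `λ`-series has positive radius, then near `0`: `exp(Σ λ_k z^k) = 2ξ(1/(1−z))`.
[cite: Keiper1992, eq. (20) p.767] -/
theorem exp_lamSeries_sum_eventuallyEq :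
    (fun z ↦ Complex.exp ((FormalMultilinearSeries.ofScalars ℂ (fun k ↦ (keiperLambdaK k : ℂ))).sum z)) =ᶠ[𝓝 (0 : ℂ)] fun z ↦ 2 * liPhi z := by
  filter_upwards [lamSeries_sum_eventuallyEq, eventually_twoPhi_mem_slitPlane] with z hz hsl
  rw [hz, Complex.exp_log (Complex.slitPlane_ne_zero hsl)]

/-- The sum of the `λ`-series is analytic on `|z| < R` whenever `R ≤ radius` (inside «the radius of
convergence», p.766). [cite: Keiper1992, §1 p.766] -/
theorem analyticOnNhd_lamSeries_sum {R : NNReal} (hR : (R : ENNReal) ≤ (FormalMultilinearSeries.ofScalars ℂ (fun k ↦ (keiperLambdaK k : ℂ))).radius)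
    (hR0 : 0 < R) : AnalyticOnNhd ℂ (FormalMultilinearSeries.ofScalars ℂ (fun k ↦ (keiperLambdaK k : ℂ))).sum (Metric.ball 0 R) := by
  have hpos : 0 < (FormalMultilinearSeries.ofScalars ℂ (fun k ↦ (keiperLambdaK k : ℂ))).radius := lt_of_lt_of_le (by exact_mod_cast hR0) hR
  have hps := (FormalMultilinearSeries.ofScalars ℂ (fun k ↦ (keiperLambdaK k : ℂ))).hasFPowerSeriesOnBall hpos
  intro z hz
  refine hps.analyticAt_of_mem ?_
  have hz' : z ∈ Metric.eball (0 : ℂ) R := by rwa [Metric.eball_coe]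
  exact Metric.eball_subset_eball hR hz'

/-- `ξ(1/(1−z))` is analytic on the half-plane `Re z < 1` (where `1/(1−z)` is); Keiper's `ξ(1/s)` off
`s = 0`. [cite: Keiper1992, §1 p.765; Li1997, eq. (1.3)] -/
theorem analyticOnNhd_liPhi_re_lt : AnalyticOnNhd ℂ liPhi {z : ℂ | z.re < 1} := by
  intro z hz
  have hz1 : z ≠ 1 := by rintro rfl; simp at hz
  exact (differentiable_riemannXi.analyticAt _).comp (analyticAt_liMap hz1)

/-- **Keiper's «by (19)/(20)» argument, sufficiency half**: if the `λ`-series `Σ λ_k z^k` has radius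
of convergence `≥ 1`, the Riemann hypothesis holds.  Proof: its sum `g` is then holomorphic on the unit
disc and `exp ∘ g = 2ξ(1/(1−z))` near `0`, hence on the whole disc (identity theorem); so
`ξ(1/(1−z)) ≠ 0` for `|z| < 1`, i.e. `ξ(w) ≠ 0` for `Re w > ½` (tree `riemannHypothesis_of_liPhi_ne_zero`,
Li 1997). [cite: Keiper1992, §1 p.765–766] -/
theorem riemannHypothesis_of_one_le_radius (h : 1 ≤ (FormalMultilinearSeries.ofScalars ℂ (fun k ↦ (keiperLambdaK k : ℂ))).radius) : RiemannHypothesis := by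
  have hA : AnalyticOnNhd ℂ (FormalMultilinearSeries.ofScalars ℂ (fun k ↦ (keiperLambdaK k : ℂ))).sum (Metric.ball 0 1) := by
    have := analyticOnNhd_lamSeries_sum (R := 1) (by exact_mod_cast h) one_pos
    simpa using this
  have hf : AnalyticOnNhd ℂ (fun z ↦ Complex.exp ((FormalMultilinearSeries.ofScalars ℂ (fun k ↦ (keiperLambdaK k : ℂ))).sum z)) (Metric.ball 0 1) :=
    fun z hz ↦ (hA z hz).cexp
  have hg : AnalyticOnNhd ℂ (fun z ↦ 2 * liPhi z) (Metric.ball 0 1) :=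
    fun z hz ↦ analyticAt_const.mul
      (analyticOnNhd_liPhi_re_lt z (by
        have : |z.re| < 1 := (Complex.abs_re_le_norm z).trans_lt (by simpa using hz)
        exact (abs_lt.1 this).2))
  have heq := hf.eqOn_of_preconnected_of_eventuallyEq hg (convex_ball (0 : ℂ) 1).isPreconnected
    (Metric.mem_ball_self one_pos) exp_lamSeries_sum_eventuallyEq
  refine riemannHypothesis_of_liPhi_ne_zero fun z hz h0 ↦ ?_
  have := heq hz
  simp only [h0, mul_zero] at this
  exact Complex.exp_ne_zero _ this

/-- The `λ`-series has radius of convergence `≤ 1`, unconditionally: by Hardy's theorem (tree) there is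
a zero `ρ = ½ + it` of `ξ` ON the critical line, so `2ξ(1/(1−z))` vanishes at `z₀ = 1 − 1/ρ`, `|z₀| = 1`;
if the radius exceeded `1`, `exp(Σ λ_k z^k) = 2ξ(1/(1−z))` would persist up to `z₀` (identity theorem on
the convex region `|z| < R`, `Re z < 1`), which is absurd. [cite: Keiper1992, §1 p.765–766] -/
theorem radius_lamSeries_le_one : (FormalMultilinearSeries.ofScalars ℂ (fun k ↦ (keiperLambdaK k : ℂ))).radius ≤ 1 := by
  by_contra hlt
  rw [not_le] at hlt
  obtain ⟨R, h1R, hRrad⟩ := ENNReal.lt_iff_exists_nnreal_btwn.1 hlt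
  have h1R' : (1 : ℝ) < R := by exact_mod_cast h1R
  -- a zero of `ξ` on the critical line (Hardy)
  obtain ⟨t, ht⟩ := Hardy.riemannZeta_zeros_on_critical_line_infinite.nonempty
  set ρ : ℂ := 1 / 2 + t * I with hρ
  have hρre : ρ.re = 1 / 2 := by simp [hρ]
  have hξρ : riemannXi ρ = 0 :=
    (riemannXi_eq_zero_iff_holds ρ).2 ⟨ht, by rw [hρre]; norm_num, by rw [hρre]; norm_num⟩
  have hρ0 : ρ ≠ 0 := fun h ↦ by rw [h] at hρre; norm_num at hρre
  set z₀ : ℂ := 1 - 1 / ρ with hz₀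
  have hz₀norm : ‖z₀‖ = 1 := norm_one_sub_inv_eq_one hρre
  have hliMap : liMap z₀ = ρ := by
    rw [liMap, hz₀]; field_simp; ring_nf
  have hφz₀ : liPhi z₀ = 0 := by
    simp only [liPhi, Function.comp_apply, hliMap, hξρ]
  have hz₀re : z₀.re < 1 := by
    rw [hz₀, Complex.sub_re, Complex.one_re, one_div, Complex.inv_re, hρre]
    have : 0 < Complex.normSq ρ := Complex.normSq_pos.2 hρ0
    have : (0 : ℝ) < 1 / 2 / Complex.normSq ρ := by positivity
    linarith
  -- the region
  set U : Set ℂ := Metric.ball (0 : ℂ) R ∩ {z : ℂ | z.re < 1} with hU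
  have hUconv : Convex ℝ U := (convex_ball (0 : ℂ) R).inter (convex_halfSpace_re_lt 1)
  have h0U : (0 : ℂ) ∈ U := ⟨Metric.mem_ball_self (by exact_mod_cast (zero_lt_one.trans h1R')),
    by simp⟩
  have hz₀U : z₀ ∈ U := ⟨by rw [Metric.mem_ball, dist_zero_right, hz₀norm]; exact h1R', hz₀re⟩
  have hA : AnalyticOnNhd ℂ (FormalMultilinearSeries.ofScalars ℂ (fun k ↦ (keiperLambdaK k : ℂ))).sum (Metric.ball 0 R) :=
    analyticOnNhd_lamSeries_sum hRrad.le (by exact_mod_cast (zero_lt_one.trans h1R'))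
  have hf : AnalyticOnNhd ℂ (fun z ↦ Complex.exp ((FormalMultilinearSeries.ofScalars ℂ (fun k ↦ (keiperLambdaK k : ℂ))).sum z)) U :=
    fun z hz ↦ (hA z hz.1).cexp
  have hg : AnalyticOnNhd ℂ (fun z ↦ 2 * liPhi z) U :=
    fun z hz ↦ analyticAt_const.mul (analyticOnNhd_liPhi_re_lt z hz.2)
  have heq := hf.eqOn_of_preconnected_of_eventuallyEq hg hUconv.isPreconnected h0U
    exp_lamSeries_sum_eventuallyEq
  have := heq hz₀U
  simp only [hφz₀, mul_zero] at this
  exact Complex.exp_ne_zero _ this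

/-- `Re (1/(1−z)) > ½` for `|z| < 1` (the unit disc is mapped onto the half-plane `Re > ½`). [cite: Li1997, p. 326] -/
theorem half_lt_re_liMap {z : ℂ} (hz : ‖z‖ < 1) : 1 / 2 < (liMap z).re := by
  have hz1 : z ≠ 1 := by rintro rfl; simp at hz
  have h1z : (1 : ℂ) - z ≠ 0 := sub_ne_zero.2 (Ne.symm hz1)
  have hns : 0 < Complex.normSq (1 - z) := Complex.normSq_pos.2 h1z
  rw [liMap, Complex.inv_re, Complex.normSq_apply]
  simp only [Complex.sub_re, Complex.one_re, Complex.sub_im, Complex.one_im, zero_sub, mul_neg,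
    neg_mul, neg_neg]
  have hz2 : z.re * z.re + z.im * z.im < 1 := by
    have := Complex.sq_norm z
    rw [Complex.normSq_apply] at this
    nlinarith [norm_nonneg z]
  rw [Complex.normSq_apply] at hns
  simp only [Complex.sub_re, Complex.one_re, Complex.sub_im, Complex.one_im, zero_sub, mul_neg,
    neg_mul, neg_neg] at hns
  rw [lt_div_iff₀ hns]
  nlinarith

/-- Under RH, `ξ(1/(1−z)) ≠ 0` on the unit disc. [cite: Li1997, p. 326] -/
theorem liPhi_ne_zero_of_rh (hRH : RiemannHypothesis) {z : ℂ} (hz : z ∈ Metric.ball (0 : ℂ) 1) :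
    liPhi z ≠ 0 := by
  have hz' : ‖z‖ < 1 := by simpa using hz
  intro h0
  have h0' : riemannXi (liMap z) = 0 := h0
  obtain ⟨hζ, h0re, h1re⟩ := (riemannXi_eq_zero_iff_holds _).1 h0'
  have hntriv : ¬∃ n : ℕ, liMap z = -2 * (n + 1) := by
    rintro ⟨n, hn⟩
    rw [hn] at h0re
    simp at h0re
    linarith [n.cast_nonneg (α := ℝ)]
  have hne1 : liMap z ≠ 1 := by
    intro h1; rw [h1] at hζ; exact riemannZeta_one_ne_zero hζ
  have := hRH (liMap z) hζ hntriv hne1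
  linarith [half_lt_re_liMap hz']

/-- The Taylor coefficients of `liPhi'/liPhi` at `0` are `(k+1)λ_{k+1}` (it is the derivative of
`log 2ξ(1/(1−z))` near `0`). [cite: Keiper1992, eq. (20) p.767] -/
theorem iteratedDeriv_logDeriv_liPhi_zero (k : ℕ) :
    iteratedDeriv k (fun z ↦ deriv liPhi z / liPhi z) 0 =
      ((k + 1)! : ℂ) * (keiperLambdaK (k + 1) : ℂ) := by
  have hev : (fun z ↦ deriv liPhi z / liPhi z) =ᶠ[𝓝 (0 : ℂ)]
      deriv (fun z ↦ Complex.log (2 * liPhi z)) := by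
    filter_upwards [eventually_twoPhi_mem_slitPlane, Metric.ball_mem_nhds (0 : ℂ) one_pos]
      with z hsl hz
    have hφ0 : liPhi z ≠ 0 := by
      intro h; have := Complex.slitPlane_ne_zero hsl; rw [h, mul_zero] at this; exact this rfl
    have hd : HasDerivAt liPhi (deriv liPhi z) z :=
      (differentiableOn_liPhi.differentiableAt (Metric.isOpen_ball.mem_nhds hz)).hasDerivAt
    have hL := (hd.const_mul 2).clog hsl
    rw [hL.deriv]
    field_simp
  rw [hev.iteratedDeriv_eq, ← iteratedDeriv_succ', keiperLambdaK_coe]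
  have : ((k + 1)! : ℂ) ≠ 0 := by exact_mod_cast (Nat.factorial_pos _).ne'
  field_simp

/-- **Necessity half**: under RH the `λ`-series has radius `≥ 1` — `liPhi'/liPhi` is holomorphic on the
unit disc (no zeros of `ξ(1/(1−z))` there), so its Taylor series, with coefficients `(k+1)λ_{k+1}`,
converges on the disc. [cite: Keiper1992, §1 p.765–766] -/
theorem one_le_radius_of_rh (hRH : RiemannHypothesis) : 1 ≤ (FormalMultilinearSeries.ofScalars ℂ (fun k ↦ (keiperLambdaK k : ℂ))).radius := by
  have hφA : AnalyticOnNhd ℂ liPhi (Metric.ball 0 1) :=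
    differentiableOn_liPhi.analyticOnNhd Metric.isOpen_ball
  have hD : DifferentiableOn ℂ (fun z ↦ deriv liPhi z / liPhi z) (Metric.ball 0 1) :=
    (hφA.deriv.differentiableOn).div differentiableOn_liPhi (fun z hz ↦ liPhi_ne_zero_of_rh hRH hz)
  refine ENNReal.le_of_forall_nnreal_lt fun r hr ↦ ?_
  have hr1 : (r : ℝ) < 1 := by exact_mod_cast hr
  have hrmem : ((r : ℝ) : ℂ) ∈ Metric.ball (0 : ℂ) 1 := by
    simp [abs_of_nonneg r.coe_nonneg, hr1]
  have hT := Complex.hasSum_taylorSeries_on_ball hD hrmem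
  -- the terms `d_k r^k` of the convergent Taylor series tend to `0`
  have h0 := hT.summable.tendsto_atTop_zero
  simp only [sub_zero, smul_eq_mul, iteratedDeriv_logDeriv_liPhi_zero] at h0
  have hnorm0 := (tendsto_zero_iff_norm_tendsto_zero.1 h0)
  -- hence `‖λ_{k+1}‖ r^{k+1} → 0`
  have hbound : ∀ k : ℕ, ‖(FormalMultilinearSeries.ofScalars ℂ (fun k ↦ (keiperLambdaK k : ℂ))) (k + 1)‖ * (r : ℝ) ^ (k + 1) ≤
      ‖((k ! : ℂ))⁻¹ * (((r : ℝ) : ℂ) ^ k * (((k + 1)! : ℂ) * (keiperLambdaK (k + 1) : ℂ)))‖ := by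
    intro k
    have hk : ((k ! : ℂ))⁻¹ * (((r : ℝ) : ℂ) ^ k * (((k + 1)! : ℂ) * (keiperLambdaK (k + 1) : ℂ))) =
        ((k + 1 : ℕ) : ℂ) * ((keiperLambdaK (k + 1) : ℂ) * ((r : ℝ) : ℂ) ^ k) := by
      rw [Nat.factorial_succ]; push_cast
      have : (k ! : ℂ) ≠ 0 := by exact_mod_cast (Nat.factorial_pos _).ne'
      field_simp
    have hval : ‖((k ! : ℂ))⁻¹ * (((r : ℝ) : ℂ) ^ k * (((k + 1)! : ℂ) * (keiperLambdaK (k + 1) : ℂ)))‖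
        = ((k + 1 : ℕ) : ℝ) * (|keiperLambdaK (k + 1)| * (r : ℝ) ^ k) := by
      rw [hk, norm_mul, norm_mul, norm_pow, Complex.norm_natCast, Complex.norm_real, Complex.norm_real,
        Real.norm_of_nonneg r.coe_nonneg, Real.norm_eq_abs]
    rw [hval, FormalMultilinearSeries.ofScalars_norm, Complex.norm_real, Real.norm_eq_abs]
    have ha : 0 ≤ |keiperLambdaK (k + 1)| := abs_nonneg _
    have hrk : 0 ≤ (r : ℝ) ^ k := pow_nonneg r.coe_nonneg k
    have hk1 : (1 : ℝ) ≤ ((k + 1 : ℕ) : ℝ) := by exact_mod_cast Nat.succ_pos k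
    calc |keiperLambdaK (k + 1)| * (r : ℝ) ^ (k + 1)
        = |keiperLambdaK (k + 1)| * (r : ℝ) ^ k * r := by rw [pow_succ]; ring
      _ ≤ |keiperLambdaK (k + 1)| * (r : ℝ) ^ k * 1 := by gcongr
      _ ≤ ((k + 1 : ℕ) : ℝ) * (|keiperLambdaK (k + 1)| * (r : ℝ) ^ k) := by
          rw [mul_one]; nlinarith [mul_nonneg ha hrk]
  have hlim : Tendsto (fun k ↦ ‖(FormalMultilinearSeries.ofScalars ℂ (fun k ↦ (keiperLambdaK k : ℂ))) (k + 1)‖ * (r : ℝ) ^ (k + 1)) atTop (𝓝 0) :=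
    squeeze_zero (fun k ↦ mul_nonneg (norm_nonneg _) (pow_nonneg r.coe_nonneg _)) hbound hnorm0
  have hlim' : Tendsto (fun k ↦ ‖(FormalMultilinearSeries.ofScalars ℂ (fun k ↦ (keiperLambdaK k : ℂ))) k‖ * (r : ℝ) ^ k) atTop (𝓝 0) :=
    (Filter.tendsto_add_atTop_iff_nat 1).1 hlim
  exact (FormalMultilinearSeries.ofScalars ℂ (fun k ↦ (keiperLambdaK k : ℂ))).le_radius_of_tendsto hlim'

/-- **Discharge of `Keiper1992_rh_iff_radius_log`** ([Keiper1992] §1 p.765–766, for the series (20)):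
`RH ⟺` the radius of convergence of `Σ λ_k z^k` is `1`.  `⟹`: `one_le_radius_of_rh` and the
unconditional `radius_lamSeries_le_one` (Hardy); `⟸`: `riemannHypothesis_of_one_le_radius`.
LABEL: RH-EQUIVALENT (l.1) — an equivalence, neither side asserted; nothing here bears on the truth
of RH. [cite: Keiper1992, §1 p.765–766] -/
theorem _root_.Literature.NumberTheory.LFunctions.Keiper1992_rh_iff_radius_log_holds :
    Keiper1992_rh_iff_radius_log := by
  constructor
  · intro hRH
    exact le_antisymm radius_lamSeries_le_one (one_le_radius_of_rh hRH)
  · intro h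
    exact riemannHypothesis_of_one_le_radius h.symm.le


/-! ### «If the `|τ_k|` are bounded, then by (19) the Riemann hypothesis must be true» (p.769) -/

/-- `u_m := m λ_m` (`= λ^L_m`); the second difference of `u` is `τ` ((35)), so
`u_{m+1} − u_m = Σ_{i≤m} τ_i`. [cite: Keiper1992, eq. (35) p.769] -/
theorem mul_keiperLambdaK_succ_sub (m : ℕ) :
    ((m : ℝ) + 1) * keiperLambdaK (m + 1) - m * keiperLambdaK m = ∑ i ∈ range (m + 1), keiperTau i := by
  induction m with
  | zero =>
    have h0 : (keiperTau 0 : ℂ) = ((nicolasBeta / 2 : ℝ) : ℂ) := by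
      rw [Keiper1992_eq24, zetaZeroPowerSum_one]; push_cast; ring
    have h0' : keiperTau 0 = nicolasBeta / 2 := by exact_mod_cast h0
    simp [keiperLambdaK, keiperLiCoeff_one, h0']
  | succ m ih =>
    rw [Finset.sum_range_succ, ← ih]
    have h35 := Keiper1992_eq35 (m := m + 1) (by omega)
    simp only [Nat.add_sub_cancel] at h35
    push_cast at h35 ⊢
    linear_combination -h35

/-- If `|τ_k| ≤ C` for all `k` then `|m λ_m| ≤ C m²`. [cite: Keiper1992, p.769] -/
theorem abs_mul_keiperLambdaK_le {C : ℝ} (hC : ∀ k, |keiperTau k| ≤ C) (m : ℕ) :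
    |(m : ℝ) * keiperLambdaK m| ≤ C * (m : ℝ) ^ 2 := by
  have hC0 : 0 ≤ C := (abs_nonneg _).trans (hC 0)
  induction m with
  | zero => simp
  | succ m ih =>
    have hΔ : |((m : ℝ) + 1) * keiperLambdaK (m + 1) - m * keiperLambdaK m| ≤ C * (m + 1) := by
      rw [mul_keiperLambdaK_succ_sub]
      refine (Finset.abs_sum_le_sum_abs _ _).trans ?_
      calc ∑ i ∈ range (m + 1), |keiperTau i| ≤ ∑ _i ∈ range (m + 1), C :=
            Finset.sum_le_sum fun i _ ↦ hC i
        _ = C * (m + 1) := by simp; ring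
    have := abs_sub_abs_le_abs_sub (((m : ℝ) + 1) * keiperLambdaK (m + 1)) (m * keiperLambdaK m)
    push_cast
    nlinarith

/-- Bounded `τ_k` force the `λ`-series to have radius `≥ 1` (`|λ_m| ≤ C m`). [cite: Keiper1992, p.769] -/
theorem one_le_radius_of_tau_bounded {C : ℝ} (hC : ∀ k, |keiperTau k| ≤ C) :
    1 ≤ (FormalMultilinearSeries.ofScalars ℂ (fun k ↦ (keiperLambdaK k : ℂ))).radius := by
  have hC0 : 0 ≤ C := (abs_nonneg _).trans (hC 0)
  refine ENNReal.le_of_forall_nnreal_lt fun r hr ↦ ?_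
  have hr1 : (r : ℝ) < 1 := by exact_mod_cast hr
  have hlam : ∀ m : ℕ, |keiperLambdaK m| ≤ C * m := by
    intro m
    rcases Nat.eq_zero_or_pos m with rfl | hm
    · simp [keiperLambdaK]
    · have h := abs_mul_keiperLambdaK_le hC m
      rw [abs_mul, Nat.abs_cast] at h
      have hm' : (0 : ℝ) < m := by exact_mod_cast hm
      rw [show C * (m : ℝ) ^ 2 = (C * m) * m by ring] at h
      exact le_of_mul_le_mul_left (by linarith [h]) hm' |> fun _ ↦ by nlinarith
  have hbound : ∀ m : ℕ, ‖(FormalMultilinearSeries.ofScalars ℂ (fun k ↦ (keiperLambdaK k : ℂ))) m‖ * (r : ℝ) ^ m ≤ C * ((m : ℝ) * (r : ℝ) ^ m) := by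
    intro m
    rw [FormalMultilinearSeries.ofScalars_norm, Complex.norm_real, Real.norm_eq_abs]
    have hrm : 0 ≤ (r : ℝ) ^ m := pow_nonneg r.coe_nonneg m
    nlinarith [hlam m]
  have hlim0 : Tendsto (fun m : ℕ ↦ C * ((m : ℝ) * (r : ℝ) ^ m)) atTop (𝓝 0) := by
    have := (tendsto_self_mul_const_pow_of_lt_one r.coe_nonneg hr1).const_mul C
    simpa using this
  have hlim : Tendsto (fun m ↦ ‖(FormalMultilinearSeries.ofScalars ℂ (fun k ↦ (keiperLambdaK k : ℂ))) m‖ * (r : ℝ) ^ m) atTop (𝓝 0) :=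
    squeeze_zero (fun m ↦ mul_nonneg (norm_nonneg _) (pow_nonneg r.coe_nonneg _)) hbound hlim0
  exact (FormalMultilinearSeries.ofScalars ℂ (fun k ↦ (keiperLambdaK k : ℂ))).le_radius_of_tendsto hlim

/-- **Discharge of `Keiper1992_rh_of_tau_bounded`** ([Keiper1992] p.769: «if the `|τ_k|` are bounded,
then by (19) the Riemann hypothesis must be true»): bounded `τ_k` ⟹ `|λ_m| ≤ Cm` by (35) ⟹ the
`λ`-series (20) has radius `≥ 1` ⟹ RH (`riemannHypothesis_of_one_le_radius`).  RH-FREE implication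
whose hypothesis is of RH strength; nothing here bears on the truth of RH. [cite: Keiper1992, p.769] -/
theorem _root_.Literature.NumberTheory.LFunctions.Keiper1992_rh_of_tau_bounded_holds :
    Keiper1992_rh_of_tau_bounded := by
  rintro ⟨C, hC⟩
  exact riemannHypothesis_of_one_le_radius (one_le_radius_of_tau_bounded hC)

/-! ### (25), (29): finite and infinite re-expansions of `τ_k`, `λ_k` in the `σ_j` -/

/-- Reindexing `Icc 1 n` by `range n`. [folklore] -/
private theorem sum_Icc_one_eq_sum_range' {M : Type*} [AddCommMonoid M] (g : ℕ → M) (n : ℕ) :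
    ∑ m ∈ Icc 1 n, g m = ∑ i ∈ range n, g (i + 1) := by
  rw [← Finset.Ico_add_one_right_eq_Icc, Finset.sum_Ico_eq_sum_range]
  simp only [Nat.add_sub_cancel, add_comm 1]

/-- `(s ↦ conj k(conj s))^{(n)}(z) = conj (k^{(n)}(conj z))`, unconditionally. [folklore] -/
private theorem iteratedDeriv_conj_conj' (k : ℂ → ℂ) (n : ℕ) (z : ℂ) :
    iteratedDeriv n (fun s ↦ conj (k (conj s))) z = conj (iteratedDeriv n k (conj z)) := by
  induction n generalizing z with
  | zero => simp
  | succ n ih =>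
    have e : iteratedDeriv n (fun s ↦ conj (k (conj s))) = fun s ↦ conj (iteratedDeriv n k (conj s)) :=
      funext ih
    rw [iteratedDeriv_succ, e, iteratedDeriv_succ]
    set g := iteratedDeriv n k
    by_cases h : DifferentiableAt ℂ g (conj z)
    · have h1 := h.hasDerivAt.conj_conj
      rw [Complex.conj_conj] at h1
      exact h1.deriv
    · have h2 : ¬DifferentiableAt ℂ (fun s ↦ conj (g (conj s))) z := by
        intro hd
        have h3 := hd.hasDerivAt.conj_conj
        have hg : (conj ∘ (fun s ↦ conj (g (conj s))) ∘ conj) = g := by funext s; simp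
        rw [hg] at h3
        exact h h3.differentiableAt
      rw [deriv_zero_of_not_differentiableAt h, deriv_zero_of_not_differentiableAt h2, map_zero]

/-- If `F` commutes with conjugation near the real point `x`, every `F^{(n)}(x)` is real. [folklore] -/
private theorem im_iteratedDeriv_eq_zero_of_eventually_conj' {F : ℂ → ℂ} {x : ℝ}
    (h : ∀ᶠ z in 𝓝 (x : ℂ), F (conj z) = conj (F z)) (n : ℕ) :
    (iteratedDeriv n F x).im = 0 := by
  have hG : (fun s ↦ conj (F (conj s))) =ᶠ[𝓝 (x : ℂ)] F := by
    have hc : Tendsto (fun z : ℂ ↦ conj z) (𝓝 (x : ℂ)) (𝓝 (x : ℂ)) := by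
      have := (Complex.continuous_conj.tendsto (x : ℂ))
      rwa [Complex.conj_ofReal] at this
    filter_upwards [hc.eventually h] with z hz
    rw [Complex.conj_conj] at hz
    exact hz.symm
  have e := hG.iteratedDeriv_eq n
  rw [iteratedDeriv_conj_conj', Complex.conj_ofReal] at e
  exact Complex.conj_eq_iff_im.1 e

/-- Keiper's `σ_k` are real (`k ≥ 1`): `σ_k = (−1)^{k+1} k a_k` ((13)) and the Taylor coefficients
`a_k` of `log ξ` at `1` are real (`ξ(s̄) = conj ξ(s)`, `ξ(1) = ½ > 0`). [cite: Keiper1992, eq. (15) p.767] -/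
theorem zetaZeroPowerSum_im {k : ℕ} (hk : 1 ≤ k) : (zetaZeroPowerSum k).im = 0 := by
  have hsl : ∀ᶠ s in 𝓝 ((1 : ℝ) : ℂ), riemannXi s ∈ slitPlane := by
    have hc : ContinuousAt riemannXi ((1 : ℝ) : ℂ) := (differentiable_riemannXi _).continuousAt
    refine hc.eventually_mem (isOpen_slitPlane.mem_nhds ?_)
    rw [Complex.ofReal_one, riemannXi_one, Complex.mem_slitPlane_iff]; norm_num
  have hreal : (iteratedDeriv k (fun s ↦ Complex.log (riemannXi s)) 1).im = 0 := by
    have := im_iteratedDeriv_eq_zero_of_eventually_conj' (F := fun s ↦ Complex.log (riemannXi s))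
      (x := 1) (by
        filter_upwards [hsl] with s hs
        rw [riemannXi_conj_holds, Complex.log_conj_eq_ite, if_neg (Complex.mem_slitPlane_iff_arg.1 hs).1]) k
    simpa using this
  rw [Coffey2008_eq34_holds k hk, Xiao2020.logXiTaylorCoeff]
  have e : (-1 : ℂ) ^ (k + 1) * (k : ℂ) *
      (iteratedDeriv k (fun s ↦ Complex.log (riemannXi s)) 1 / (k ! : ℂ)) =
      (((-1 : ℝ) ^ (k + 1) * k / (k ! : ℕ) : ℝ) : ℂ) *
        iteratedDeriv k (fun s ↦ Complex.log (riemannXi s)) 1 := by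
    push_cast; ring
  rw [e, Complex.im_ofReal_mul, hreal, mul_zero]

/-- `(σ_j : ℂ)` equals the cast of its real part (`j ≥ 1`). [cite: Keiper1992, eq. (15) p.767] -/
theorem zetaZeroPowerSum_eq_re {j : ℕ} (hj : 1 ≤ j) :
    zetaZeroPowerSum j = ((zetaZeroPowerSum j).re : ℂ) :=
  Complex.ext (by simp) (by simp [zetaZeroPowerSum_im hj])

/-- `kλ_k = −Σ_{j=1}^k (−1)^j C(k,j) σ_j` as a complex identity ((27) = [Coffey2008] (3.5)).
[cite: Keiper1992, eq. (27) p.768] -/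
theorem mul_keiperLambdaK_eq_sum {k : ℕ} (hk : 1 ≤ k) :
    (k : ℂ) * (keiperLambdaK k : ℂ) =
      -∑ j ∈ Icc 1 k, (-1 : ℂ) ^ j * (k.choose j : ℂ) * zetaZeroPowerSum j := by
  have h := keiperLiCoeff_eq_sum_zetaZeroPowerSum' hk
  rw [keiperLiCoeff_eq_mul_keiperLambdaK hk] at h
  have h' := congrArg (fun x : ℝ ↦ (x : ℂ)) h
  push_cast at h'
  rw [h']
  congr 1
  refine Finset.sum_congr rfl fun j hj ↦ ?_
  rw [← zetaZeroPowerSum_eq_re (Finset.mem_Icc.1 hj).1]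

/-- From (18): `Σ_{i≥0} C(i, j−1) σ_{i+1} = (−1)^j σ_j` for `j ≥ 1` (the terms `i < j−1` vanish).
[cite: Keiper1992, eq. (18) p.767] -/
theorem hasSum_choose_mul_zetaZeroPowerSum {j : ℕ} (hj : 1 ≤ j) :
    HasSum (fun i : ℕ ↦ ((i.choose (j - 1) : ℕ) : ℂ) * zetaZeroPowerSum (i + 1))
      ((-1) ^ j * zetaZeroPowerSum j) := by
  obtain ⟨j', rfl⟩ : ∃ j', j = j' + 1 := ⟨j - 1, by omega⟩
  simp only [Nat.add_sub_cancel]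
  have h18 := Keiper1992_eq18 j'
  refine (hasSum_nat_add_iff' j').1 ?_
  have hzero : ∑ i ∈ range j', ((i.choose j' : ℕ) : ℂ) * zetaZeroPowerSum (i + 1) = 0 := by
    refine Finset.sum_eq_zero fun i hi ↦ ?_
    rw [Nat.choose_eq_zero_of_lt (Finset.mem_range.1 hi)]; simp
  rw [hzero, sub_zero]
  convert h18 using 2

/-- Vandermonde: `Σ_{j=1}^k C(k,j) C(i,j−1) = C(i+k, k−1)`. [folklore] -/
private theorem sum_choose_mul_choose_pred {k : ℕ} (hk : 1 ≤ k) (i : ℕ) :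
    ∑ j ∈ Icc 1 k, (k.choose j) * (i.choose (j - 1)) = (i + k).choose (k - 1) := by
  rw [Nat.add_choose_eq, Finset.Nat.sum_antidiagonal_eq_sum_range_succ_mk, sum_Icc_one_eq_sum_range']
  simp only [Nat.succ_eq_add_one, Nat.sub_add_cancel hk, Nat.add_sub_cancel]
  refine Finset.sum_congr rfl fun a ha ↦ ?_
  have ha' := Finset.mem_range.1 ha
  rw [mul_comm, ← Nat.choose_symm (show a + 1 ≤ k by omega), show k - (a + 1) = k - 1 - a by omega]

/-- **Discharge of `Keiper1992_eq29`** ([Keiper1992] (29) p.768): `λ_k = −(1/k) Σ_{j≥1} C(j+k−1,k−1) σ_j`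
(`k ≥ 1`), from (27) by substituting (18) and Vandermonde's identity. [cite: Keiper1992, eq. (29) p.768] -/
theorem _root_.Literature.NumberTheory.LFunctions.Keiper1992_eq29_holds : Keiper1992_eq29 := by
  intro k hk
  have hs := hasSum_sum (s := Icc 1 k)
    (f := fun j i ↦ -((k.choose j : ℂ)) * ((((i.choose (j - 1) : ℕ) : ℂ) * zetaZeroPowerSum (i + 1))))
    (a := fun j ↦ -((k.choose j : ℂ)) * ((-1) ^ j * zetaZeroPowerSum j))
    (fun j hj ↦ (hasSum_choose_mul_zetaZeroPowerSum (Finset.mem_Icc.1 hj).1).mul_left _)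
  have hval : ∑ j ∈ Icc 1 k, -((k.choose j : ℂ)) * ((-1) ^ j * zetaZeroPowerSum j) =
      (k : ℂ) * keiperLambdaK k := by
    rw [mul_keiperLambdaK_eq_sum hk, ← Finset.sum_neg_distrib]
    refine Finset.sum_congr rfl fun j _ ↦ by ring
  rw [hval] at hs
  refine hs.congr_fun fun i ↦ ?_
  have hV := sum_choose_mul_choose_pred hk i
  have hV' : ∑ j ∈ Icc 1 k, ((k.choose j : ℂ)) * ((i.choose (j - 1) : ℕ) : ℂ) =
      (((i + k).choose (k - 1) : ℕ) : ℂ) := by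
    rw [← hV]; push_cast; rfl
  refine Eq.symm ?_
  calc ∑ j ∈ Icc 1 k, -((k.choose j : ℂ)) * ((((i.choose (j - 1) : ℕ) : ℂ) * zetaZeroPowerSum (i + 1)))
      = -(∑ j ∈ Icc 1 k, ((k.choose j : ℂ)) * ((i.choose (j - 1) : ℕ) : ℂ)) * zetaZeroPowerSum (i + 1) := by
        rw [neg_mul, Finset.sum_mul, ← Finset.sum_neg_distrib]
        refine Finset.sum_congr rfl fun j _ ↦ by ring
    _ = -((((i + k).choose (k - 1) : ℕ) : ℂ) * zetaZeroPowerSum (i + 1)) := by rw [hV']; ring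

/-- Second-difference Pascal identity: for `k ≥ 1`, `1 ≤ j`,
`C(k+1,j) − 2C(k,j) + C(k−1,j) = C(k−1, j−2)` for `j ≥ 2` and `= 0` for `j = 1`. [folklore] -/
private theorem choose_second_diff {k j : ℕ} (hk : 1 ≤ k) (hj : 2 ≤ j) :
    ((k + 1).choose j : ℤ) - 2 * (k.choose j : ℤ) + ((k - 1).choose j : ℤ) = ((k - 1).choose (j - 2) : ℤ) := by
  obtain ⟨k', rfl⟩ : ∃ k', k = k' + 1 := ⟨k - 1, by omega⟩
  obtain ⟨j', rfl⟩ : ∃ j', j = j' + 2 := ⟨j - 2, by omega⟩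
  simp only [Nat.add_sub_cancel]
  have h1 := Nat.choose_succ_succ' (k' + 1) (j' + 1)   -- C(k'+2, j'+2) = C(k'+1, j'+1) + C(k'+1, j'+2)
  have h2 := Nat.choose_succ_succ' k' (j' + 1)         -- C(k'+1, j'+2) = C(k', j'+1) + C(k', j'+2)
  have h3 := Nat.choose_succ_succ' k' j'               -- C(k'+1, j'+1) = C(k', j') + C(k', j'+1)
  push_cast [h1, h2, h3]
  ring

/-- **Discharge of `Keiper1992_eq25`** ([Keiper1992] (25) p.768): `τ_k = Σ_{j=1}^k C(k−1,j−1)(−1)^j σ_{j+1}`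
(`k ≥ 1`), from (35) and (27) by Pascal's rule (second differences of binomial coefficients).
[cite: Keiper1992, eq. (25) p.768] -/
theorem _root_.Literature.NumberTheory.LFunctions.Keiper1992_eq25_holds : Keiper1992_eq25 := by
  intro k hk
  -- `S n := Σ_{j=1}^{k+1} (−1)^j C(n,j) σ_j`, so that `n λ_n = −S n` for `n ≤ k+1`
  set σ : ℕ → ℂ := fun j ↦ zetaZeroPowerSum j with hσ
  set S : ℕ → ℂ := fun n ↦ ∑ i ∈ range (k + 1), (-1 : ℂ) ^ (i + 1) * (n.choose (i + 1) : ℂ) * σ (i + 1)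
    with hS
  have hu : ∀ n : ℕ, n ≤ k + 1 → (n : ℂ) * keiperLambdaK n = -S n := by
    intro n hnk
    rcases Nat.eq_zero_or_pos n with rfl | hn
    · simp [hS]
    · rw [mul_keiperLambdaK_eq_sum hn, hS, sum_Icc_one_eq_sum_range']
      congr 1
      have hsub : range n ⊆ range (k + 1) := Finset.range_subset_range.2 (by omega)
      refine Finset.sum_subset hsub fun i hi hi' ↦ ?_
      have : n < i + 1 := by simp at hi hi'; omega
      rw [Nat.choose_eq_zero_of_lt this]; simp
  -- (35) in `ℂ`
  have h35 := congrArg (fun x : ℝ ↦ (x : ℂ)) (Keiper1992_eq35 hk)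
  push_cast at h35
  have hk2 : ((k : ℂ) - 1) = ((k - 1 : ℕ) : ℂ) := by rw [Nat.cast_sub hk]; push_cast; ring
  have e1 := hu (k + 1) le_rfl
  have e2 := hu k (by omega)
  have e3 := hu (k - 1) (by omega)
  push_cast at e1
  rw [← hk2] at e3
  have hτ : (keiperTau k : ℂ) = -(S (k + 1) - 2 * S k + S (k - 1)) := by
    rw [h35]; linear_combination e1 - 2 * e2 + e3
  -- second differences of the binomial coefficients
  have hdiff : S (k + 1) - 2 * S k + S (k - 1) = ∑ i ∈ range (k + 1),
      ((-1 : ℂ) ^ (i + 1) * σ (i + 1)) *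
        (((k + 1).choose (i + 1) : ℂ) - 2 * (k.choose (i + 1) : ℂ) + ((k - 1).choose (i + 1) : ℂ)) := by
    simp only [hS, Finset.mul_sum, ← Finset.sum_sub_distrib, ← Finset.sum_add_distrib]
    exact Finset.sum_congr rfl fun i _ ↦ by ring
  rw [hτ, hdiff, Finset.sum_range_succ', sum_Icc_one_eq_sum_range']
  -- the `j = 1` term vanishes
  have h0 : (((k + 1).choose (0 + 1) : ℂ) - 2 * (k.choose (0 + 1) : ℂ) + ((k - 1).choose (0 + 1) : ℂ)) = 0 := by
    simp only [zero_add, Nat.choose_one_right, ← hk2]; push_cast; ring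
  rw [h0, mul_zero, add_zero, ← Finset.sum_neg_distrib]
  refine Finset.sum_congr rfl fun i _ ↦ ?_
  have hd := choose_second_diff hk (j := i + 1 + 1) (by omega)
  simp only [Nat.add_sub_cancel] at hd ⊢
  have hd' : (((k + 1).choose (i + 1 + 1) : ℂ) - 2 * (k.choose (i + 1 + 1) : ℂ) + ((k - 1).choose (i + 1 + 1) : ℂ))
      = ((k - 1).choose i : ℂ) := by exact_mod_cast hd
  rw [hd']
  ring

/-! ### «RH ⟺ radius 1» for the series (19) `ξ'(1/s)/ξ(1/s) = Σ τ_k (1−s)^k` -/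

/-- Geometric control of the `τ_k` is inherited by `mλ_m` through (35) summed twice
(`mul_keiperLambdaK_succ_sub`): if `|τ_k| ≤ C q^k` with `q ≥ 1`, then `|m λ_m| ≤ C m² q^m`.
[cite: Keiper1992, eq. (35) p.769] -/
theorem abs_mul_keiperLambdaK_le_geom {C q : ℝ} (hq : 1 ≤ q) (hC : ∀ k, |keiperTau k| ≤ C * q ^ k)
    (m : ℕ) : |(m : ℝ) * keiperLambdaK m| ≤ C * (m : ℝ) ^ 2 * q ^ m := by
  have hC0 : 0 ≤ C := by have := (abs_nonneg _).trans (hC 0); simpa using this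
  induction m with
  | zero => simp
  | succ m ih =>
    have hqpos : 0 ≤ q ^ m := pow_nonneg (zero_le_one.trans hq) m
    have hΔ : |((m : ℝ) + 1) * keiperLambdaK (m + 1) - m * keiperLambdaK m| ≤ C * (m + 1) * q ^ m := by
      rw [mul_keiperLambdaK_succ_sub]
      refine (Finset.abs_sum_le_sum_abs _ _).trans ?_
      calc ∑ i ∈ range (m + 1), |keiperTau i| ≤ ∑ _i ∈ range (m + 1), C * q ^ m :=
            Finset.sum_le_sum fun i hi ↦ (hC i).trans
              (mul_le_mul_of_nonneg_left
                (pow_le_pow_right₀ hq (Nat.lt_succ_iff.1 (Finset.mem_range.1 hi))) hC0)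
        _ = C * (m + 1) * q ^ m := by simp; ring
    have h1 := abs_sub_abs_le_abs_sub (((m : ℝ) + 1) * keiperLambdaK (m + 1)) (m * keiperLambdaK m)
    have hqm1 : q ^ m ≤ q ^ (m + 1) := pow_le_pow_right₀ hq (Nat.le_succ m)
    have hstep : C * (m : ℝ) ^ 2 * q ^ m + C * (m + 1) * q ^ m ≤
        C * ((m : ℝ) + 1) ^ 2 * q ^ (m + 1) := by
      have hm0 : (0 : ℝ) ≤ m := Nat.cast_nonneg m
      calc C * (m : ℝ) ^ 2 * q ^ m + C * (m + 1) * q ^ m = C * ((m : ℝ) ^ 2 + (m + 1)) * q ^ m := by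
            ring
        _ ≤ C * ((m : ℝ) + 1) ^ 2 * q ^ m := by
            apply mul_le_mul_of_nonneg_right _ hqpos
            exact mul_le_mul_of_nonneg_left (by nlinarith) hC0
        _ ≤ C * ((m : ℝ) + 1) ^ 2 * q ^ (m + 1) :=
            mul_le_mul_of_nonneg_left hqm1 (by positivity)
    push_cast
    linarith [ih, hΔ, h1, hstep]

/-- If `|τ_k| ≤ C q^k` with `q ≥ 1`, then `|λ_m| ≤ C m q^m`, so the `λ`-series (20) converges on
`|z| < 1/q`: every `r` with `rq < 1` is below its radius. [cite: Keiper1992, §1 p.765–766; eq. (35) p.769] -/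
theorem le_radius_lamSeries_of_tau_le {C q : ℝ} (hq : 1 ≤ q) (hC : ∀ k, |keiperTau k| ≤ C * q ^ k)
    {r : ℝ≥0} (hr : (r : ℝ) * q < 1) :
    (r : ℝ≥0∞) ≤ (FormalMultilinearSeries.ofScalars ℂ (fun k ↦ (keiperLambdaK k : ℂ))).radius := by
  have hq0 : 0 ≤ q := zero_le_one.trans hq
  have hlam : ∀ m : ℕ, |keiperLambdaK m| ≤ C * m * q ^ m := by
    intro m
    rcases Nat.eq_zero_or_pos m with rfl | hm
    · simp [keiperLambdaK]
    · have h := abs_mul_keiperLambdaK_le_geom hq hC m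
      rw [abs_mul, Nat.abs_cast] at h
      have hm' : (0 : ℝ) < m := by exact_mod_cast hm
      rw [show C * (m : ℝ) ^ 2 * q ^ m = (C * m * q ^ m) * m by ring] at h
      nlinarith
  have hbound : ∀ m : ℕ,
      ‖(FormalMultilinearSeries.ofScalars ℂ (fun k ↦ (keiperLambdaK k : ℂ))) m‖ * (r : ℝ) ^ m ≤
        C * ((m : ℝ) * ((r : ℝ) * q) ^ m) := by
    intro m
    rw [FormalMultilinearSeries.ofScalars_norm, Complex.norm_real, Real.norm_eq_abs]
    have hrm : 0 ≤ (r : ℝ) ^ m := pow_nonneg r.coe_nonneg m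
    calc |keiperLambdaK m| * (r : ℝ) ^ m ≤ (C * m * q ^ m) * (r : ℝ) ^ m :=
          mul_le_mul_of_nonneg_right (hlam m) hrm
      _ = C * ((m : ℝ) * ((r : ℝ) * q) ^ m) := by rw [mul_pow]; ring
  have hlim0 : Tendsto (fun m : ℕ ↦ C * ((m : ℝ) * ((r : ℝ) * q) ^ m)) atTop (𝓝 0) := by
    have := (tendsto_self_mul_const_pow_of_lt_one (mul_nonneg r.coe_nonneg hq0) hr).const_mul C
    simpa using this
  have hlim : Tendsto (fun m ↦
      ‖(FormalMultilinearSeries.ofScalars ℂ (fun k ↦ (keiperLambdaK k : ℂ))) m‖ * (r : ℝ) ^ m)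
      atTop (𝓝 0) :=
    squeeze_zero (fun m ↦ mul_nonneg (norm_nonneg _) (pow_nonneg r.coe_nonneg _)) hbound hlim0
  exact (FormalMultilinearSeries.ofScalars ℂ (fun k ↦ (keiperLambdaK k : ℂ))).le_radius_of_tendsto hlim

/-- **«By (19)», sufficiency direction**: if the `τ`-series (19) has radius of convergence `≥ 1`, so
does the `λ`-series (20) (for `r < r' < 1`: `|τ_k| ≤ C r'^{−k}`, hence `|λ_m| ≤ C m r'^{−m}`).
[cite: Keiper1992, §1 p.765–766] -/
theorem one_le_radius_lamSeries_of_one_le_radius_tauSeries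
    (h : 1 ≤ (FormalMultilinearSeries.ofScalars ℂ (fun k ↦ (keiperTau k : ℂ))).radius) :
    1 ≤ (FormalMultilinearSeries.ofScalars ℂ (fun k ↦ (keiperLambdaK k : ℂ))).radius := by
  refine ENNReal.le_of_forall_nnreal_lt fun r hr ↦ ?_
  obtain ⟨r', hrr', hr'1⟩ := ENNReal.lt_iff_exists_nnreal_btwn.1 hr
  have hrr'ℝ : (r : ℝ) < r' := by exact_mod_cast hrr'
  have hr'1ℝ : (r' : ℝ) < 1 := by exact_mod_cast hr'1
  have hr'0 : (0 : ℝ) < r' := lt_of_le_of_lt r.coe_nonneg hrr'ℝ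
  have hr'0' : 0 < r' := by exact_mod_cast hr'0
  obtain ⟨C, -, hC⟩ :=
    (FormalMultilinearSeries.ofScalars ℂ (fun k ↦ (keiperTau k : ℂ))).norm_le_div_pow_of_pos_of_lt_radius
      hr'0' (hr'1.trans_le h)
  have hq : (1 : ℝ) ≤ (r' : ℝ)⁻¹ := (one_le_inv₀ hr'0).2 hr'1ℝ.le
  have hC' : ∀ k, |keiperTau k| ≤ C * ((r' : ℝ)⁻¹) ^ k := by
    intro k
    have := hC k
    rw [FormalMultilinearSeries.ofScalars_norm, Complex.norm_real, Real.norm_eq_abs] at this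
    simpa [div_eq_mul_inv, inv_pow] using this
  exact le_radius_lamSeries_of_tau_le hq hC' (by
    rw [← div_eq_mul_inv, div_lt_one hr'0]; exact hrr'ℝ)

/-- Under RH, `(ξ'/ξ) ∘ liMap` is holomorphic on the unit disc (`ξ(1/(1−z)) ≠ 0` there,
`liPhi_ne_zero_of_rh`). [cite: Keiper1992, §1 p.765–766; Li1997, p. 326] -/
theorem differentiableOn_logDeriv_comp_liMap_of_rh (hRH : RiemannHypothesis) :
    DifferentiableOn ℂ (logDeriv riemannXi ∘ liMap) (Metric.ball 0 1) := by
  intro z hz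
  have hz' : ‖z‖ < 1 := by simpa using hz
  have hz1 : z ≠ 1 := by rintro rfl; simp at hz'
  have hξ : riemannXi (liMap z) ≠ 0 := liPhi_ne_zero_of_rh hRH hz
  have h1 : DifferentiableAt ℂ (deriv riemannXi) (liMap z) :=
    ((differentiable_riemannXi.analyticAt (liMap z)).deriv).differentiableAt
  have h2 : DifferentiableAt ℂ riemannXi (liMap z) := differentiable_riemannXi _
  have hL : logDeriv riemannXi = fun w ↦ deriv riemannXi w / riemannXi w :=
    funext fun w ↦ logDeriv_apply riemannXi w
  have hd : DifferentiableAt ℂ (logDeriv riemannXi) (liMap z) := by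
    rw [hL]; exact h1.div h2 hξ
  exact (hd.comp z (hasDerivAt_liMap hz1).differentiableAt).differentiableWithinAt

/-- **Necessity direction, `≥ 1`**: under RH the `τ`-series (19) has radius `≥ 1` — it is the Taylor
series at `0` of `(ξ'/ξ) ∘ liMap` (`keiperTau_coe`), holomorphic on the unit disc under RH.
[cite: Keiper1992, §1 p.765–766] -/
theorem one_le_radius_tauSeries_of_rh (hRH : RiemannHypothesis) :
    1 ≤ (FormalMultilinearSeries.ofScalars ℂ (fun k ↦ (keiperTau k : ℂ))).radius := by
  have hD := differentiableOn_logDeriv_comp_liMap_of_rh hRH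
  refine ENNReal.le_of_forall_nnreal_lt fun r hr ↦ ?_
  have hr1 : (r : ℝ) < 1 := by exact_mod_cast hr
  have hrmem : ((r : ℝ) : ℂ) ∈ Metric.ball (0 : ℂ) 1 := by
    simp [abs_of_nonneg r.coe_nonneg, hr1]
  have hT := Complex.hasSum_taylorSeries_on_ball hD hrmem
  have h0 := hT.summable.tendsto_atTop_zero
  have h0' : Tendsto (fun n ↦ (keiperTau n : ℂ) * ((r : ℝ) : ℂ) ^ n) atTop (𝓝 0) := by
    refine h0.congr fun n ↦ ?_
    rw [sub_zero, smul_eq_mul, smul_eq_mul, keiperTau_coe]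
    ring
  have hlim : Tendsto (fun n ↦
      ‖(FormalMultilinearSeries.ofScalars ℂ (fun k ↦ (keiperTau k : ℂ))) n‖ * (r : ℝ) ^ n)
      atTop (𝓝 0) := by
    refine (tendsto_zero_iff_norm_tendsto_zero.1 h0').congr fun n ↦ ?_
    rw [norm_mul, norm_pow, Complex.norm_real, Complex.norm_real, Real.norm_of_nonneg r.coe_nonneg,
      FormalMultilinearSeries.ofScalars_norm, Complex.norm_real]
  exact (FormalMultilinearSeries.ofScalars ℂ (fun k ↦ (keiperTau k : ℂ))).le_radius_of_tendsto hlim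

/-- The sum of the `τ`-series is `Σ' τ_k z^k`. [cite: Keiper1992, eq. (19) p.767] -/
theorem tauSeries_sum_eq (z : ℂ) :
    (FormalMultilinearSeries.ofScalars ℂ (fun k ↦ (keiperTau k : ℂ))).sum z =
      ∑' k, (keiperTau k : ℂ) * z ^ k := by
  have := FormalMultilinearSeries.ofScalars_sum_eq (E := ℂ) (fun k ↦ (keiperTau k : ℂ)) z
  simpa [FormalMultilinearSeries.ofScalarsSum, smul_eq_mul] using this

/-- On `|z| < ½` the `τ`-series sums to `ξ'/ξ(1/(1−z))`: (19) with `s = 1 − z`.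
[cite: Keiper1992, eq. (19) p.767] -/
theorem tauSeries_sum_eq_logDeriv {z : ℂ} (hz : ‖z‖ < 1 / 2) :
    (FormalMultilinearSeries.ofScalars ℂ (fun k ↦ (keiperTau k : ℂ))).sum z =
      logDeriv riemannXi (liMap z) := by
  have h19 := Keiper1992_eq19 (s := 1 - z) (by rwa [sub_sub_cancel_left, norm_neg])
  simp only [sub_sub_cancel] at h19
  rw [tauSeries_sum_eq, show liMap z = (1 - z)⁻¹ from rfl]
  exact h19.tsum_eq

/-- The sum of the `τ`-series is analytic on `|z| < R` whenever `0 < R ≤ radius`.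
[cite: Keiper1992, §1 p.766] -/
theorem analyticOnNhd_tauSeries_sum {R : ℝ≥0}
    (hR : (R : ℝ≥0∞) ≤ (FormalMultilinearSeries.ofScalars ℂ (fun k ↦ (keiperTau k : ℂ))).radius)
    (hR0 : 0 < R) :
    AnalyticOnNhd ℂ (FormalMultilinearSeries.ofScalars ℂ (fun k ↦ (keiperTau k : ℂ))).sum
      (Metric.ball 0 R) := by
  have hpos : 0 < (FormalMultilinearSeries.ofScalars ℂ (fun k ↦ (keiperTau k : ℂ))).radius :=
    lt_of_lt_of_le (by exact_mod_cast hR0) hR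
  have hps := (FormalMultilinearSeries.ofScalars ℂ (fun k ↦ (keiperTau k : ℂ))).hasFPowerSeriesOnBall hpos
  intro z hz
  refine hps.analyticAt_of_mem ?_
  have hz' : z ∈ Metric.eball (0 : ℂ) R := by rwa [Metric.eball_coe]
  exact Metric.eball_subset_eball hR hz'

/-- **Necessity direction, `≤ 1` (unconditional)**: the `τ`-series (19) has radius `≤ 1`.  By Hardy's
theorem (tree) there is a zero `ρ₀` of `ξ` ON the critical line, i.e. `z₀ = 1 − 1/ρ₀` with `|z₀| = 1`
is a zero of `ξ ∘ liMap`, of some order `n ≥ 1`.  If the radius exceeded `1`, the sum `g` would be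
holomorphic on `|z| < R`, `R > 1`, and the identity `g · (ξ∘liMap) · liMap² = (ξ∘liMap)'` (valid on
`|z| < ½` by (19)) would persist on the convex region `|z| < R, Re z < 1` containing `z₀` (identity
theorem); comparing orders of vanishing at `z₀` (`≥ n` on the left, `= n − 1` on the right) is absurd —
i.e. `z₀` is a POLE of `ξ'(1/s)/ξ(1/s)` on the circle of radius `1`. [cite: Keiper1992, §1 p.765–766] -/
theorem radius_tauSeries_le_one :
    (FormalMultilinearSeries.ofScalars ℂ (fun k ↦ (keiperTau k : ℂ))).radius ≤ 1 := by
  by_contra hlt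
  rw [not_le] at hlt
  obtain ⟨R, h1R, hRrad⟩ := ENNReal.lt_iff_exists_nnreal_btwn.1 hlt
  have h1R' : (1 : ℝ) < R := by exact_mod_cast h1R
  have hR0 : (0 : ℝ) < R := zero_lt_one.trans h1R'
  -- a zero of `ξ` on the critical line (Hardy)
  obtain ⟨t, ht⟩ := Hardy.riemannZeta_zeros_on_critical_line_infinite.nonempty
  set ρ : ℂ := 1 / 2 + t * I with hρ
  have hρre : ρ.re = 1 / 2 := by simp [hρ]
  have hξρ : riemannXi ρ = 0 :=
    (riemannXi_eq_zero_iff_holds ρ).2 ⟨ht, by rw [hρre]; norm_num, by rw [hρre]; norm_num⟩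
  have hρ0 : ρ ≠ 0 := fun h ↦ by rw [h] at hρre; norm_num at hρre
  set z₀ : ℂ := 1 - 1 / ρ with hz₀
  have hz₀norm : ‖z₀‖ = 1 := norm_one_sub_inv_eq_one hρre
  have hliMap : liMap z₀ = ρ := by
    rw [liMap, hz₀]; field_simp; ring_nf
  have hφz₀ : liPhi z₀ = 0 := by
    simp only [liPhi, Function.comp_apply, hliMap, hξρ]
  have hz₀re : z₀.re < 1 := by
    rw [hz₀, Complex.sub_re, Complex.one_re, one_div, Complex.inv_re, hρre]
    have : 0 < Complex.normSq ρ := Complex.normSq_pos.2 hρ0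
    have : (0 : ℝ) < 1 / 2 / Complex.normSq ρ := by positivity
    linarith
  have hz₀1 : z₀ ≠ 1 := by rintro h; rw [h] at hz₀re; simp at hz₀re
  -- the region and the two holomorphic functions
  set U : Set ℂ := Metric.ball (0 : ℂ) R ∩ {z : ℂ | z.re < 1} with hU
  have hUconv : Convex ℝ U := (convex_ball (0 : ℂ) R).inter (convex_halfSpace_re_lt 1)
  have hUopen : IsOpen U := Metric.isOpen_ball.inter (isOpen_lt Complex.continuous_re continuous_const)
  have h0U : (0 : ℂ) ∈ U := ⟨Metric.mem_ball_self hR0, by simp⟩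
  have hz₀U : z₀ ∈ U := ⟨by rw [Metric.mem_ball, dist_zero_right, hz₀norm]; exact h1R', hz₀re⟩
  set g : ℂ → ℂ := (FormalMultilinearSeries.ofScalars ℂ (fun k ↦ (keiperTau k : ℂ))).sum with hg
  have hgA : AnalyticOnNhd ℂ g (Metric.ball 0 R) :=
    analyticOnNhd_tauSeries_sum hRrad.le (by exact_mod_cast hR0)
  have hAan : AnalyticOnNhd ℂ (fun z ↦ g z * liPhi z * liMap z ^ 2) U := fun z hz ↦
    ((hgA z hz.1).mul (analyticOnNhd_liPhi_re_lt z hz.2)).mul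
      ((analyticAt_liMap (by rintro rfl; exact absurd hz.2 (by simp))).pow 2)
  have hBan : AnalyticOnNhd ℂ (deriv liPhi) U := fun z hz ↦ analyticOnNhd_liPhi_re_lt.deriv z hz.2
  -- near `0` the two agree, by (19)
  have hAB0 : (fun z ↦ g z * liPhi z * liMap z ^ 2) =ᶠ[𝓝 0] deriv liPhi := by
    filter_upwards [Metric.ball_mem_nhds (0 : ℂ) (by norm_num : (0 : ℝ) < 1 / 2),
      eventually_twoPhi_mem_slitPlane] with z hz hsl
    have hz' : ‖z‖ < 1 / 2 := by simpa using hz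
    have hz1 : z ≠ 1 := by rintro rfl; norm_num at hz'
    have hφ0 : riemannXi (liMap z) ≠ 0 := by
      intro h
      have := Complex.slitPlane_ne_zero hsl
      rw [show liPhi z = riemannXi (liMap z) from rfl, h, mul_zero] at this
      exact this rfl
    have hd2 : HasDerivAt liPhi (deriv riemannXi (liMap z) * liMap z ^ 2) z :=
      (differentiable_riemannXi (liMap z)).hasDerivAt.comp z (hasDerivAt_liMap hz1)
    rw [hd2.deriv, hg, tauSeries_sum_eq_logDeriv hz', logDeriv_apply,
      show liPhi z = riemannXi (liMap z) from rfl]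
    field_simp
  have hAB : Set.EqOn (fun z ↦ g z * liPhi z * liMap z ^ 2) (deriv liPhi) U :=
    hAan.eqOn_of_preconnected_of_eventuallyEq hBan hUconv.isPreconnected h0U hAB0
  -- local structure of `liPhi` at `z₀`: a zero of finite order `n ≥ 1`
  have hφan : AnalyticAt ℂ liPhi z₀ := analyticOnNhd_liPhi_re_lt z₀ hz₀re
  have hne : ¬ (∀ᶠ z in 𝓝 z₀, liPhi z = 0) := by
    intro hev
    have hzero := analyticOnNhd_liPhi_re_lt.eqOn_zero_of_preconnected_of_eventuallyEq_zero
      (convex_halfSpace_re_lt 1).isPreconnected hz₀re hev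
    have := hzero (show (0 : ℂ) ∈ {z : ℂ | z.re < 1} by simp)
    rw [liPhi_zero] at this
    norm_num at this
  obtain ⟨n, h, hhan, hh0, hfac⟩ := hφan.exists_eventuallyEq_pow_smul_nonzero_iff.2 hne
  have hn : n ≠ 0 := by
    rintro rfl
    have := hfac.self_of_nhds
    rw [pow_zero, one_smul, hφz₀] at this
    exact hh0 this.symm
  -- the derivative of the factorisation near `z₀`
  have hderiv : deriv liPhi =ᶠ[𝓝 z₀]
      fun z ↦ (n : ℂ) * (z - z₀) ^ (n - 1) * h z + (z - z₀) ^ n * deriv h z := by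
    have hfac' : liPhi =ᶠ[𝓝 z₀] fun z ↦ (z - z₀) ^ n • h z := hfac
    have h1 : deriv liPhi =ᶠ[𝓝 z₀] deriv (fun z ↦ (z - z₀) ^ n • h z) := hfac'.deriv
    filter_upwards [h1, hhan.eventually_analyticAt] with z hz1 hz2
    rw [hz1]
    have hp : HasDerivAt (fun w : ℂ ↦ (w - z₀) ^ n) ((n : ℂ) * (z - z₀) ^ (n - 1) * 1) z :=
      ((hasDerivAt_id z).sub_const z₀).pow n
    have hH : HasDerivAt h (deriv h z) z := hz2.differentiableAt.hasDerivAt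
    have hprod : HasDerivAt (fun w ↦ (w - z₀) ^ n * h w)
        ((n : ℂ) * (z - z₀) ^ (n - 1) * 1 * h z + (z - z₀) ^ n * deriv h z) z := hp.mul hH
    rw [show (fun w ↦ (w - z₀) ^ n • h w) = fun w ↦ (w - z₀) ^ n * h w from rfl, hprod.deriv]
    ring
  -- on a punctured neighbourhood of `z₀`: `n h + (z − z₀) h' = (z − z₀) · g · h · liMap²`
  have key : ∀ᶠ z in 𝓝[≠] z₀,
      (n : ℂ) * h z + (z - z₀) * deriv h z = (z - z₀) * (g z * h z * liMap z ^ 2) := by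
    rw [eventually_nhdsWithin_iff]
    filter_upwards [hUopen.mem_nhds hz₀U, hfac, hderiv] with z hzU hzf hzd hzne
    have hABz := hAB hzU
    simp only at hABz
    rw [hzd, hzf, smul_eq_mul] at hABz
    have hzz : (z - z₀) ≠ 0 := sub_ne_zero.2 hzne
    have hpow : (z - z₀) ^ n = (z - z₀) * (z - z₀) ^ (n - 1) := by
      rw [← pow_succ', Nat.sub_add_cancel (Nat.pos_of_ne_zero hn)]
    rw [hpow] at hABz
    apply mul_left_cancel₀ (pow_ne_zero (n - 1) hzz)
    linear_combination (-1 : ℂ) * hABz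
  -- both sides are continuous at `z₀`; take the limit
  have hLc : ContinuousAt (fun z ↦ (n : ℂ) * h z + (z - z₀) * deriv h z) z₀ :=
    (continuousAt_const.mul hhan.continuousAt).add
      ((continuousAt_id.sub continuousAt_const).mul hhan.deriv.continuousAt)
  have hRc : ContinuousAt (fun z ↦ (z - z₀) * (g z * h z * liMap z ^ 2)) z₀ :=
    (continuousAt_id.sub continuousAt_const).mul
      (((hgA z₀ hz₀U.1).continuousAt.mul hhan.continuousAt).mul
        ((analyticAt_liMap hz₀1).continuousAt.pow 2))
  have hlim := tendsto_nhds_unique ((hLc.tendsto.mono_left nhdsWithin_le_nhds).congr' key)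
    (hRc.tendsto.mono_left nhdsWithin_le_nhds)
  simp only [sub_self, zero_mul, add_zero] at hlim
  exact hh0 ((mul_eq_zero.1 hlim).resolve_left (Nat.cast_ne_zero.2 hn))

/-- **Discharge of `Keiper1992_rh_iff_radius_logDeriv`** ([Keiper1992] §1 p.765–766, for the series
(19) `ξ'(1/s)/ξ(1/s) = Σ τ_k (1−s)^k`): `RH ⟺` the radius of convergence of `Σ τ_k z^k` is `1`.
`⟹`: `one_le_radius_tauSeries_of_rh` and the unconditional `radius_tauSeries_le_one` (Hardy zero =
pole on the unit circle); `⟸`: radius `≥ 1` for (19) gives radius `≥ 1` for (20) through (35)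
(`one_le_radius_lamSeries_of_one_le_radius_tauSeries`), whence RH (`riemannHypothesis_of_one_le_radius`).
LABEL: RH-EQUIVALENT (l.1) — an equivalence, neither side asserted; nothing here bears on the truth
of RH. [cite: Keiper1992, §1 p.765–766] -/
theorem _root_.Literature.NumberTheory.LFunctions.Keiper1992_rh_iff_radius_logDeriv_holds :
    Keiper1992_rh_iff_radius_logDeriv := by
  constructor
  · intro hRH
    exact le_antisymm radius_tauSeries_le_one (one_le_radius_tauSeries_of_rh hRH)
  · intro h
    exact riemannHypothesis_of_one_le_radius
      (one_le_radius_lamSeries_of_one_le_radius_tauSeries h.symm.le)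

end Keiper1992

end Literature.NumberTheory.LFunctions
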